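import Summits.BirchSwinnertonDyer.BirchSwinnertonDyer.Theorems.RamifiedSevenEllipticUnitsQuadraticRamificationAway
import Summits.BirchSwinnertonDyer.BirchSwinnertonDyer.Theorems.RamifiedSevenEllipticUnitsRigidityCoefficients
import Summits.BirchSwinnertonDyer.BirchSwinnertonDyer.Theorems.RamifiedSevenEllipticUnitsPinnedCharacterRigiditySeven
import Literature.NumberTheory.EllipticCurves.AnalyticRankProofs
import Literature.NumberTheory.EllipticCurves.AdditiveReductionSemistableModelProofs
import HarnessLib

set_option linter.dupNamespace false
set_option autoImplicit false

/-!
# K7r value crux `EllipticUnitValueSevenOfGZK` (stmt-BirchSwinnertonDyer-19945), line `rubin-formula-zp`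
# v4.2 — H_QR AT THE FRAME PRIME WITHOUT GROSS (8.2.7): «`ψ` ramified at `𝔭`» from the `L`-pinning alone
# (cell `bsd-cm`, seat `bsd-cm-k7r-c3` g13; helper, `--supports` 19945; nothing about BSD asserted)

HONEST FRAMING. In the skeleton of record v4.2 (`bd085e9ecccbb7e3`) the displayed PRINT stub
`stub_printFactsSevenLine = Hecke_functionalEquation_infinityType ∧ Gross_conductorExponent_baseChange_eq_two_mul
∧ Deuring_exists_heckeCharacter_of_maximalCM_withUnitValues` feeds its GROSS conjunct into exactly one
place: the `𝔭`-part of H_QR (`X12.O11.RamifiedCMQuadraticRamificationAtZp W 7`: every Deuring-type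
character `ψ` pinned to a curve of the frame is RAMIFIED at `𝔭 ∋ 7` and `ψ²` is unramified wherever `ψ`
ramifies), through seat g11's `QuadraticRamification.not_isUnramifiedAt_and_sq_isUnramifiedAt_of_cmFieldDiscr_of_gross`
and the line owner's `QuadraticRamificationOfGross.quadraticRamificationAtZp_seven_of_gross_of_away`.
The second conjunct is already a kernel theorem WITHOUT Gross (seat g11,
`QuadraticRamification.sq_isUnramifiedAt_everywhere_of_unitValues_of_rigidityAtZp`: `ψ²` is unramified
EVERYWHERE, from Deuring-with-unit-values and the pure rigidity H_Rig⁰ — the latter now the tree theorem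
`pinnedCharacterRigidityAtZp W p`, p515907). THIS FILE proves the first conjunct «`ψ` is RAMIFIED at `𝔭`»
UNCONDITIONALLY, from the `L`-pinning `L(ψ, s) = L(V, s)` alone, so that H_QR on 𝒞₇ follows from
Deuring-with-unit-values only (`quadraticRamificationAtZp_seven_of_unitValues`), and Gross's conductor
formula is consumed NOWHERE in the v4.2 chain (the displayed H_Facts may drop it at the next
re-registration — the line owner's / planner's pen, not this file's).

MECHANISM (`Rigidity.not_isUnramifiedAt_of_heckeLFunction_eq_LSeries_of_lFunction_eq_zero`, general: a
quadratic field `K`, a prime `p ∣ d_K`, the prime `𝔭 ∋ p` of `K`, ANY Hecke character `ψ` of `K` and ANY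
Weierstrass curve `V` over a number field with `a_p(V) = 0`).
* (R1) (seat k7r-c2, `Rigidity.exists_heckeLFunction_eq_LSeries_translate`): `L(ψ, s) = Σ_n b(n) n^{−(s+σ)}`
  with `b(n) = Σ_{N𝔞 = n} ψ₀(𝔞)`, `ψ = ψ₀‖·‖^σ` Weil's decomposition, `ψ₀` unitary with the ramification
  of `ψ`; the curve side `L(V, s) = Σ a_n(V) n^{−s}` has finite abscissa of convergence
  (`WeierstrassCurve.abscissaOfAbsConv_LFunction_lt_top`); Mathlib's injectivity of the Dirichlet
  transform (`LSeries.eq_of_LSeries_eventually_eq`) gives `a_n(V) = b(n)·n^{−σ}` for `n ≠ 0`.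
* At a prime `p` RAMIFIED in the quadratic field, `𝔭` is the only ideal of norm `p`
  (`LemmaXi.eq_asIdeal_of_dvd_discr`, `LemmaXi.span_natCast_eq_sq_of_dvd_discr`: `p𝓞_K = 𝔭²`), so
  `b(p) = ψ₀(ϖ_𝔭)` if `ψ` is unramified at `𝔭`, of absolute value `1` (`ψ₀` unitary) — incompatible with
  `a_p(V) = 0`.
* For a curve `V/ℚ` with CM field `ℚ(√−7)` (`j ∈ {−3375, 255³}`): the isogenous globally minimal model
  `W₁` (same `L`-series; seat g11 `exists_isogenous_maximal_model`) has `ord₇ Δ_min` ODD (g11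
  `odd_padicValInt_minimalDiscriminantInt`) and `ord₇ j ≥ 0`, hence `7 ∣ Δ_min`, `7 ∣ c₄`
  (`c₄³ = j·Δ`): ADDITIVE reduction at `7`, `a₇(W₁) = 0` (tree `lFunction_eq_zero_of_dvd_of_dvd`).
RESULTS: `QuadraticRamification.not_isUnramifiedAt_of_cmFieldDiscr_eq_neg_seven` (unconditional, every `φ`
pinned to such a `V`), `…_frame` (O11 frame currency), and the Gross-free assemblies
`quadraticRamificationAtZp_seven_of_unitValues_of_rigidityAtZp : Deuring-UV → ClassCSeven W →
RamifiedCMPinnedCharacterRigidityAtZp W 7 → RamifiedCMQuadraticRamificationAtZp W 7` (drop-in for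
`…_of_gross_of_away` in `stub_quadraticRamificationSeven`) and `quadraticRamificationAtZp_seven_of_unitValues :
Deuring-UV → ClassCSeven W → RamifiedCMQuadraticRamificationAtZp W 7` (H_Rig⁰ discharged by p515907).
CONDITIONAL only on the print fact `Deuring_exists_heckeCharacter_of_maximalCM_withUnitValues` where
stated; the ramification half is unconditional. Nothing about BSD is proved or claimed.

References: J. Neukirch, *Algebraic Number Theory* (1999) VII (8.1), I (8.2)/(9.6) [NeukirchANT1999];
A. Weil, *Basic Number Theory* (1967) VII §3, §7 [WeilBNT1967]; J. Silverman, *AEC* (2009) VII.5.1(c),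
App. C §16 [SilvermanAEC2009]; J. Silverman, *Advanced Topics* (1994) II Thm. 9.2, App. A §3
[SilvermanATAEC1994]; cell texts STATUS 2026-08-27 D160/D166/D180, k7r-c3 g11 07:24Z, g13 09:16Z.
-/

noncomputable section

open scoped Classical
open Filter NumberField IsDedekindDomain WeierstrassCurve
  Literature.NumberTheory.GaloisRepresentations
  Literature.NumberTheory.LFunctions
  Literature.NumberTheory.EllipticCurves
  Literature.NumberTheory.EllipticCurves.Rank1Residual
  Summit.BirchSwinnertonDyer.Rank1Residual Summit.BirchSwinnertonDyer.Rank1Residual.X12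
  Summit.BirchSwinnertonDyer.Rank1Residual.X12.O11

namespace Summit.BirchSwinnertonDyer.BirchSwinnertonDyer.Theorems.RamifiedSevenEllipticUnits

/-! ## §1. Hecke character pinned to a curve: the coefficient identity and ramification at a
ramified prime where `a_p = 0` -/

namespace Rigidity

variable {K : Type} [Field K] [NumberField K]

/-- **Hecke-vs-curve coefficient identity.** If `heckeLFunction ψ s = V.LSeries s` for `re s > s₀`
(`ψ` ANY Hecke character of `K`, `V` ANY Weierstrass curve over a number field), then with Weil's
decomposition `ψ = ψ₀‖·‖^σ` of file (R1) (`ψ₀` unitary, same ramification, `ψ₀(ϖ_v) = ψ(ϖ_v)·Nv^σ`,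
ramification modulus `𝔪`): `a_n(V) = (Σ_{N𝔞 = n} ψ₀(𝔞))·n^{−σ}` for every `n ≠ 0`.
[cite: NeukirchANT1999, Ch. VII §8 (8.1)] [cite: WeilBNT1967, Ch. VII §7 ¶1] -/
theorem intCast_lFunction_eq_weightedCoeff_of_heckeLFunction_eq_LSeries (ψ : HeckeCharacter K)
    {F : Type} [Field F] [NumberField F] (V : WeierstrassCurve F) (s₀ : ℝ)
    (h : ∀ s : ℂ, s₀ < s.re → heckeLFunction ψ s = V.LSeries s) :
    ∃ (σ : ℝ) (ψ₀ : HeckeCharacter K) (𝔪 : Ideal (𝓞 K)), ψ₀.IsUnitary ∧ 𝔪 ≠ ⊥ ∧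
      (∀ v : HeightOneSpectrum (𝓞 K), ψ.IsUnramifiedAt v ↔ ¬ 𝔪 ≤ v.asIdeal) ∧
      (∀ v : HeightOneSpectrum (𝓞 K), ψ₀.IsUnramifiedAt v ↔ ¬ 𝔪 ≤ v.asIdeal) ∧
      (∀ v : HeightOneSpectrum (𝓞 K), ψ₀.valueAtUniformizer v =
        ψ.valueAtUniformizer v * ((Ideal.absNorm v.asIdeal : ℕ) : ℂ) ^ (σ : ℂ)) ∧
      ∀ n : ℕ, n ≠ 0 →
        ((V.LFunction n : ℤ) : ℂ) =
          NumberField.twistCount K (rayClassCoeffHom 𝔪 fun v ↦ ψ₀.valueAtUniformizer v) n *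
            (n : ℂ) ^ (-(σ : ℂ)) := by
  obtain ⟨σ, ψ₀, 𝔪, hu, h𝔪, -, hiff, hiff₀, hval, hL⟩ := exists_heckeLFunction_eq_LSeries_translate ψ
  refine ⟨σ, ψ₀, 𝔪, hu, h𝔪, hiff, hiff₀, hval, fun n hn ↦ ?_⟩
  refine LSeries.eq_of_LSeries_eventually_eq (f := fun n ↦ ((V.LFunction n : ℤ) : ℂ))
    (g := fun n ↦ NumberField.twistCount K (rayClassCoeffHom 𝔪 fun v ↦ ψ₀.valueAtUniformizer v) n *
      (n : ℂ) ^ (-(σ : ℂ)))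
    V.abscissaOfAbsConv_LFunction_lt_top (abscissaOfAbsConv_weighted_lt_top hu h𝔪 σ) ?_ hn
  -- on large reals both series ARE the common `L`-function
  rw [Filter.EventuallyEq, Filter.eventually_atTop]
  refine ⟨max s₀ (1 - σ) + 1, fun x hx ↦ ?_⟩
  have hx₀ : s₀ < ((x : ℂ)).re := by
    simp only [Complex.ofReal_re]; linarith [le_max_left s₀ (1 - σ)]
  have hx₁ : 1 - σ < ((x : ℂ)).re := by
    simp only [Complex.ofReal_re]; linarith [le_max_right s₀ (1 - σ)]
  show LSeries _ (x : ℂ) = LSeries _ (x : ℂ)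
  rw [LSeries_shift, ← hL x hx₁, h x hx₀]
  rfl

/-- **The only ideal of norm `p` at a prime RAMIFIED in a quadratic field is `𝔭`.** For `[K : ℚ] = 2`,
`p ∣ d_K` and the prime `𝔭 ∋ p` of `K`: `{𝔞 : N𝔞 = p} = {𝔭}` (`p𝓞_K = 𝔭²`, so `N𝔭 = p`; an ideal of
prime norm `p` is a prime containing `p`, hence `𝔭`). [cite: NeukirchANT1999, Ch. I §8 Prop. (8.2) and §9 Prop. (9.6)] -/
theorem setOf_absNorm_eq_of_dvd_discr (h2 : Module.finrank ℚ K = 2) {p : ℕ} [hp : Fact p.Prime]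
    (hdvd : (p : ℤ) ∣ NumberField.discr K) (𝔭 : HeightOneSpectrum (𝓞 K))
    (hp𝔭 : ((p : ℕ) : 𝓞 K) ∈ 𝔭.asIdeal) :
    {I : Ideal (𝓞 K) | Ideal.absNorm I = p} = {𝔭.asIdeal} := by
  -- `N𝔭 = p` from `p𝓞_K = 𝔭²`
  have habs : Ideal.absNorm 𝔭.asIdeal = p := by
    have hsq := congrArg Ideal.absNorm (LemmaXi.span_natCast_eq_sq_of_dvd_discr h2 hdvd 𝔭 hp𝔭)
    rw [Ideal.absNorm_span_natCast, NumberField.RingOfIntegers.rank, h2, map_pow] at hsq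
    exact (Nat.pow_left_injective two_ne_zero hsq).symm
  ext I
  simp only [Set.mem_setOf_eq, Set.mem_singleton_iff]
  constructor
  · intro hI
    haveI : I.IsPrime := Ideal.isPrime_of_irreducible_absNorm (by rw [hI]; exact hp.out)
    refine LemmaXi.eq_asIdeal_of_dvd_discr h2 hdvd 𝔭 hp𝔭 ?_
    have hmem := Ideal.absNorm_mem I
    rw [hI] at hmem
    exact_mod_cast hmem
  · rintro rfl
    exact habs

/-- The Dirichlet coefficient `Σ_{N𝔞 = p} g(𝔞)` at a prime RAMIFIED in a quadratic field is the single
term `g(𝔭)`. [cite: NeukirchANT1999, Ch. I §8 Prop. (8.2)] -/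
theorem twistCount_eq_apply_of_dvd_discr (h2 : Module.finrank ℚ K = 2) {p : ℕ} [hp : Fact p.Prime]
    (hdvd : (p : ℤ) ∣ NumberField.discr K) (𝔭 : HeightOneSpectrum (𝓞 K))
    (hp𝔭 : ((p : ℕ) : 𝓞 K) ∈ 𝔭.asIdeal) (g : Ideal (𝓞 K) →*₀ ℂ) :
    NumberField.twistCount K g p = g 𝔭.asIdeal := by
  rw [twistCount_eq_finsum, setOf_absNorm_eq_of_dvd_discr h2 hdvd 𝔭 hp𝔭, finsum_mem_singleton]

/-- **A Hecke character pinned to a curve with `a_p = 0` is RAMIFIED at the ramified prime above `p`.**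
`K` quadratic, `p ∣ d_K`, `𝔭 ∋ p`; `ψ` ANY Hecke character of `K` with `heckeLFunction ψ s = V.LSeries s`
for `re s > s₀`, where `V` is a Weierstrass curve over a number field whose `p`-th coefficient `a_p(V)`
vanishes (e.g. additive reduction at `p` over `ℚ`). Then `ψ` is ramified at `𝔭`: otherwise the `p`-th
coefficient of `L(ψ, s)` would be `ψ₀(ϖ_𝔭)·p^{−σ} ≠ 0` (`𝔭` the only ideal of norm `p`, `ψ₀` unitary).
Unconditional. [cite: NeukirchANT1999, Ch. VII §8 (8.1)] [cite: SilvermanAEC2009, App. C §16 (the local factor `1` at an additive prime)] -/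
theorem not_isUnramifiedAt_of_heckeLFunction_eq_LSeries_of_lFunction_eq_zero
    (h2 : Module.finrank ℚ K = 2) {p : ℕ} [hp : Fact p.Prime] (hdvd : (p : ℤ) ∣ NumberField.discr K)
    (𝔭 : HeightOneSpectrum (𝓞 K)) (hp𝔭 : ((p : ℕ) : 𝓞 K) ∈ 𝔭.asIdeal) (ψ : HeckeCharacter K)
    {F : Type} [Field F] [NumberField F] (V : WeierstrassCurve F) (s₀ : ℝ)
    (hL : ∀ s : ℂ, s₀ < s.re → heckeLFunction ψ s = V.LSeries s) (hV : V.LFunction p = 0) :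
    ¬ ψ.IsUnramifiedAt 𝔭 := by
  intro hunr
  obtain ⟨σ, ψ₀, 𝔪, hu, h𝔪, hiff, -, -, hcoeff⟩ :=
    intCast_lFunction_eq_weightedCoeff_of_heckeLFunction_eq_LSeries ψ V s₀ hL
  have hp0 : (p : ℂ) ≠ 0 := by exact_mod_cast hp.out.ne_zero
  have e := hcoeff p hp.out.ne_zero
  rw [hV, Int.cast_zero, twistCount_eq_apply_of_dvd_discr h2 hdvd 𝔭 hp𝔭,
    rayClassCoeffHom_asIdeal _ ((hiff 𝔭).mp hunr) h𝔪] at e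
  -- `0 = ψ₀(ϖ_𝔭) · p^{−σ}` with both factors nonzero
  have h1 : ψ₀.valueAtUniformizer 𝔭 ≠ 0 := by
    intro h0
    have := HeckeCharacter.norm_valueAtUniformizer_of_isUnitary hu 𝔭
    rw [h0, norm_zero] at this
    exact zero_ne_one this
  have h2' : (p : ℂ) ^ (-(σ : ℂ)) ≠ 0 := fun h0 ↦ hp0 ((Complex.cpow_eq_zero_iff _ _).mp h0).1
  exact mul_ne_zero h1 h2' e.symm

end Rigidity

/-! ## §2. Curves with CM field `ℚ(√−7)`: `a₇ = 0`, and every pinned character is ramified at `𝔭 ∋ 7` -/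

namespace QuadraticRamification

section CMSeven

variable {W : WeierstrassCurve ℚ} [W.IsElliptic]

/-- **`a₇(W) = 0` for a globally minimal curve with CM field `ℚ(√−7)`** (ADDITIVE reduction at `7`):
`ord₇ Δ_min` is odd (`odd_padicValInt_minimalDiscriminantInt`), so `7 ∣ Δ_min`, and `c₄³ = j·Δ` with
`ord₇ j ≥ 0` gives `7 ∣ c₄`; the local factor at `7` is `1` (tree `lFunction_eq_zero_of_dvd_of_dvd`).
[cite: SilvermanAEC2009, VII.5 Prop. 5.1(c) and App. C §16] [cite: SilvermanATAEC1994, App. A §3] -/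
theorem lFunction_seven_eq_zero [W.IsGloballyMinimal] (hj : cmFieldDiscrOfJ W.j = -7) :
    W.LFunction 7 = 0 := by
  haveI : Fact (Nat.Prime 7) := ⟨by norm_num⟩
  have hodd := odd_padicValInt_minimalDiscriminantInt hj
  have hΔ0 : W.minimalDiscriminantInt ≠ 0 := by
    intro h
    rw [h, padicValInt.zero] at hodd
    exact (Nat.not_odd_iff_even.mpr Even.zero) hodd
  have hΔpos : 1 ≤ padicValInt 7 W.minimalDiscriminantInt := by
    rcases hodd with ⟨k, hk⟩
    omega
  have hΔ : ((7 : ℕ) : ℤ) ∣ W.minimalDiscriminantInt := by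
    have := (padicValInt_dvd_iff (p := 7) 1 W.minimalDiscriminantInt).mpr (Or.inr hΔpos)
    simpa using this
  -- `7 ∣ c₄`
  have hc₄ : ((7 : ℕ) : ℤ) ∣ (integralModelInt W).c₄ := by
    by_cases h0 : (integralModelInt W).c₄ = 0
    · rw [h0]; exact dvd_zero _
    have hc : W.c₄ = ((integralModelInt W).c₄ : ℚ) := by
      conv_lhs => rw [← map_integralModelInt W]
      rw [map_c₄, eq_intCast]
    have hc0 : W.c₄ ≠ 0 := by rw [hc]; exact_mod_cast h0
    have hΔne : W.Δ ≠ 0 := W.Δ'.ne_zero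
    have hjne : W.j ≠ 0 := by
      rcases X12.j_eq_of_cmFieldDiscrOfJ_eq_neg_seven hj with h | h <;> rw [h] <;> norm_num
    -- `c₄³ = j Δ`
    have hrel : W.c₄ ^ 3 = W.j * W.Δ := by
      rw [WeierstrassCurve.j, mul_comm, ← mul_assoc, ← WeierstrassCurve.coe_Δ', Units.mul_inv, one_mul]
    have hval : (3 : ℤ) * padicValRat 7 W.c₄ = padicValRat 7 W.j + padicValRat 7 W.Δ := by
      have h := congrArg (padicValRat 7) hrel
      rw [padicValRat.pow, padicValRat.mul hjne hΔne] at h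
      exact_mod_cast h
    have hjv := padicValRat_j_nonneg hj
    have hΔv : (1 : ℤ) ≤ padicValRat 7 W.Δ := by
      rw [← cast_minimalDiscriminantInt W, padicValRat.of_int]
      exact_mod_cast hΔpos
    have hcv : (1 : ℤ) ≤ padicValRat 7 W.c₄ := by omega
    rw [hc, padicValRat.of_int] at hcv
    have := (padicValInt_dvd_iff (p := 7) 1 (integralModelInt W).c₄).mpr
      (Or.inr (by exact_mod_cast hcv))
    simpa using this
  exact lFunction_eq_zero_of_dvd_of_dvd W 7 hΔ hc₄ (dvd_refl 7)

variable {K : Type} [Field K] [NumberField K] {𝔭 : HeightOneSpectrum (𝓞 K)}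

/-- **EVERY Hecke character pinned to a curve with CM field `ℚ(√−7)` is RAMIFIED at the prime above `7`
— UNCONDITIONAL.** For `W/ℚ` elliptic with CM and `cmFieldDiscrOfJ W.j = −7` (`j ∈ {−3375, 255³}`), a
quadratic field `K` with `d_K = −7`, its prime `𝔭 ∋ 7`, and ANY Hecke character `φ` of `K` with
`heckeLFunction φ s = W.LSeries s` on `re s > 3/2`: `φ` is ramified at `𝔭`. (Pass to the isogenous
globally minimal maximal-order model — same `L`-series —, which is additive at `7`, `a₇ = 0`; then §1.)
No infinity type, no conj-equivariance, no Gross (8.2.7). [cite: SilvermanAEC2009, App. C §16]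
[cite: NeukirchANT1999, Ch. VII §8 (8.1)] -/
theorem not_isUnramifiedAt_of_cmFieldDiscr_eq_neg_seven (hCM : W.HasCM) (hj : cmFieldDiscrOfJ W.j = -7)
    (h2 : Module.finrank ℚ K = 2) (hdK : NumberField.discr K = -7)
    (h7 : ((7 : ℕ) : 𝓞 K) ∈ 𝔭.asIdeal) (φ : HeckeCharacter K)
    (hL : ∀ s : ℂ, 3 / 2 < s.re → heckeLFunction φ s = W.LSeries s) :
    ¬ φ.IsUnramifiedAt 𝔭 := by
  haveI : Fact (Nat.Prime 7) := ⟨by norm_num⟩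
  obtain ⟨W₁, _, _, -, -, hd₁, hLW⟩ := exists_isogenous_maximal_model hCM
  rw [hj] at hd₁
  have hdvd : ((7 : ℕ) : ℤ) ∣ NumberField.discr K := by rw [hdK]; norm_num
  have hL₁ : ∀ s : ℂ, 3 / 2 < s.re → heckeLFunction φ s = W₁.LSeries s := by
    intro s hs; rw [← hLW]; exact hL s hs
  exact Rigidity.not_isUnramifiedAt_of_heckeLFunction_eq_LSeries_of_lFunction_eq_zero h2 hdvd 𝔭 h7 φ
    W₁ (3 / 2) hL₁ (lFunction_seven_eq_zero hd₁)

variable {W' : WeierstrassCurve ℚ} {C : VariableChange ℚ}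

/-- **Ramification at the frame prime on 𝒞₇ — UNCONDITIONAL.** For `W ∈ 𝒞₇`, an O11 frame
`IsFrame W 7 K 𝔭 W' C`, every curve `V/ℚ` with CM and `cmFieldDiscrOfJ V.j = cmFieldDiscrOfJ W.j` and
EVERY Hecke character `φ` of `K` pinned to `V`: `¬ φ.IsUnramifiedAt 𝔭`. This is the first conjunct of the
`𝔭`-part of H_QR (`X12.O11.RamifiedCMQuadraticRamificationAtZp W 7`), formerly obtained from Gross (8.2.7)
(`not_isUnramifiedAt_and_sq_isUnramifiedAt_frame_of_gross`). [cite: SilvermanAEC2009, App. C §16]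
[cite: NeukirchANT1999, Ch. VII §8 (8.1)] -/
theorem not_isUnramifiedAt_frame [W.IsGloballyMinimal] [Fact (Nat.Prime 7)]
    [W'.IsElliptic] [W'.IsGloballyMinimal] (hC : ClassCSeven W) (hF : IsFrame W 7 K 𝔭 W' C)
    (V : WeierstrassCurve ℚ) [V.IsElliptic] (hV : V.HasCM)
    (hVj : cmFieldDiscrOfJ V.j = cmFieldDiscrOfJ W.j) (φ : HeckeCharacter K)
    (hpin : ∀ s : ℂ, 3 / 2 < s.re → heckeLFunction φ s = V.LSeries s) :
    ¬ φ.IsUnramifiedAt 𝔭 := by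
  have hdK : NumberField.discr K = -7 := by
    have h := hF.2.2.2.2.1
    rw [hC.2.1] at h
    exact h
  exact not_isUnramifiedAt_of_cmFieldDiscr_eq_neg_seven hV (hVj.trans hC.2.1) hF.2.2.2.1.1 hdK
    (by simpa using hF.2.2.2.2.2.1) φ hpin

/-- **Clause (P3) AT `w = 𝔭` on 𝒞₇ WITHOUT Gross**: the odd power `φ^{2k+1}` of a character pinned to a
curve of the frame is ramified at the frame prime, granted that `φ²` is unramified there (which
Deuring-with-unit-values + rigidity supply: `sq_isUnramifiedAt_everywhere_of_unitValues_of_rigidityAtZp`).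
[cite: BurungaleKobayashiNakamuraOta2026, §4.1 (arXiv:2608.06879 p. 25) (shape only)] [cite: SilvermanAEC2009, App. C §16] -/
theorem not_isUnramifiedAt_pow_odd_frame [W.IsGloballyMinimal] [Fact (Nat.Prime 7)]
    [W'.IsElliptic] [W'.IsGloballyMinimal] (hC : ClassCSeven W) (hF : IsFrame W 7 K 𝔭 W' C)
    (V : WeierstrassCurve ℚ) [V.IsElliptic] (hV : V.HasCM)
    (hVj : cmFieldDiscrOfJ V.j = cmFieldDiscrOfJ W.j) {φ : HeckeCharacter K}
    (hpin : ∀ s : ℂ, 3 / 2 < s.re → heckeLFunction φ s = V.LSeries s)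
    (hsq : (φ ^ 2).IsUnramifiedAt 𝔭) (k : ℕ) :
    ¬ (φ ^ (2 * k + 1)).IsUnramifiedAt 𝔭 :=
  LemmaXi.not_isUnramifiedAt_pow_odd hsq (not_isUnramifiedAt_frame hC hF V hV hVj φ hpin) k

end CMSeven

/-! ## §3. ASSEMBLY: H_QR on 𝒞₇ WITHOUT Gross (8.2.7) -/

section Assembly

variable {W : WeierstrassCurve ℚ} [W.IsElliptic] [W.IsGloballyMinimal]

/-- **H_QR ON 𝒞₇ from Deuring-with-unit-values and the pure-rigidity bridge H_Rig⁰ — NO Gross (8.2.7).**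
The typed input `X12.O11.RamifiedCMQuadraticRamificationAtZp W 7` for `W ∈ 𝒞₇`: at every O11 frame, for
every curve `V` with CM by the same field, every `cK ≠ 1` and every Deuring-type `ψ` pinned to `V`, `ψ` is
ramified at `𝔭` (§2, unconditional) and `ψ²` is unramified wherever `ψ` ramifies (indeed everywhere:
seat g11's `sq_isUnramifiedAt_everywhere_of_unitValues_of_rigidityAtZp`). DROP-IN replacement for
`QuadraticRamificationOfGross.quadraticRamificationAtZp_seven_of_gross_of_away` in the v4.2 skeleton's
`stub_quadraticRamificationSeven`, with the Gross hypothesis removed. CONDITIONAL on the print fact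
`Deuring_exists_heckeCharacter_of_maximalCM_withUnitValues`; nothing about BSD.
[cite: SilvermanATAEC1994, Ch. II Thm. 9.1 (i) and Thm. 9.2] [cite: SilvermanAEC2009, App. C §16] -/
theorem quadraticRamificationAtZp_seven_of_unitValues_of_rigidityAtZp [Fact (Nat.Prime 7)]
    (hDU : Deuring_exists_heckeCharacter_of_maximalCM_withUnitValues) (hC : ClassCSeven W)
    (hRig0 : RamifiedCMPinnedCharacterRigidityAtZp W 7) :
    RamifiedCMQuadraticRamificationAtZp W 7 :=
  fun K _ _ 𝔭 W' _ _ C hF V _ hV hVj cK hcK ψ _ _ hpin ↦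
    ⟨not_isUnramifiedAt_frame hC hF V hV hVj ψ hpin, fun w _ ↦
      sq_isUnramifiedAt_everywhere_of_unitValues_of_rigidityAtZp hDU hC hRig0 K 𝔭 W' C hF V hV hVj cK
        hcK ψ hpin w⟩

/-- **H_QR ON 𝒞₇ from Deuring-with-unit-values ALONE** (H_Rig⁰ being the tree theorem
`pinnedCharacterRigidityAtZp W 7`, p515907): `X12.O11.RamifiedCMQuadraticRamificationAtZp W 7` for every
globally minimal `W ∈ 𝒞₇`, CONDITIONAL on the single print fact
`Deuring_exists_heckeCharacter_of_maximalCM_withUnitValues` — Gross's conductor formula is no longer an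
input of H_QR. Nothing about BSD. [cite: SilvermanATAEC1994, Ch. II Thm. 9.1 (i) and Thm. 9.2] -/
theorem quadraticRamificationAtZp_seven_of_unitValues [Fact (Nat.Prime 7)]
    (hDU : Deuring_exists_heckeCharacter_of_maximalCM_withUnitValues) (hC : ClassCSeven W) :
    RamifiedCMQuadraticRamificationAtZp W 7 :=
  quadraticRamificationAtZp_seven_of_unitValues_of_rigidityAtZp hDU hC (pinnedCharacterRigidityAtZp W 7)

/-- **Class-level form in the registered currency**: `∀ W ∈ 𝒞₇, H_QR W 7` from Deuring-with-unit-values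
(the shape the skeleton's DERIVED node `stub_quadraticRamificationSeven` has, now with
`stub_printFactsSevenLine.2.2` as its only print input). CONDITIONAL; nothing about BSD.
[cite: SilvermanATAEC1994, Ch. II Thm. 9.1 (i) and Thm. 9.2] -/
theorem quadraticRamificationSeven_of_unitValues
    (hDU : Deuring_exists_heckeCharacter_of_maximalCM_withUnitValues) :
    ∀ (W : WeierstrassCurve ℚ) [W.IsElliptic] [W.IsGloballyMinimal] [Fact (Nat.Prime 7)],
      ClassCSeven W → RamifiedCMQuadraticRamificationAtZp W 7 :=
  fun _ _ _ _ hC ↦ quadraticRamificationAtZp_seven_of_unitValues hDU hC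

end Assembly

end QuadraticRamification

end Summit.BirchSwinnertonDyer.BirchSwinnertonDyer.Theorems.RamifiedSevenEllipticUnits

end
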